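import Summits.SmoothPoincare4.SmoothPoincare4.Theses.EntropyRung
import Summits.SmoothPoincare4.SmoothPoincare4.Theorems.EntropyRungSubcylindricalRecognitionInjOnVolumeComparison
import Literature.Geometry.Lorentzian.Basic
import Literature.Geometry.Lorentzian.VolumeChartFormula
import Literature.Geometry.Lorentzian.VolumeProofs

/-!
# Transplant comparison, I: the Jacobian of a transplant read in charts

Helper file of the stub `stub_transplantComparison` (U3) of line `collapsed-ends-usc`, crux
`EntropyRung.NoncompactShrinkerGap` (stmt-SmoothPoincare4-10868): the fact-free change of variables
under a `(1 ± η)`-transplant `N × ℝ → M` (see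
`EntropyRungNoncompactShrinkerGapStubTransplantComparison.lean` for the statement and the plan).

This file: the identification `ℝ³ × ℝ ≅ ℝ⁴` (`exists_prodEquiv`: a continuous linear
equivalence with `‖L(u,s)‖² = ‖u‖² + s²`, measure preserving), the differential of
`(z, t) ↦ (φ_N⁻¹ z, t)` (`mfderiv_chartSymm_prod`), and the **pointwise Jacobian bounds**
`jacobian_mul_density_bounds`: for `Φ` with `(1-η)(h(v,v)+s²) ≤ g(dΦ(v,s), dΦ(v,s)) ≤ (1+η)(h(v,v)+s²)`,
`(1-η)² √det h_{ij} ≤ |det D(φ_M ∘ Φ ∘ (φ_N⁻¹ × id)) ∘ L⁻¹| √det g_{ij} ≤ (1+η)² √det h_{ij}`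
(linearise both metrics by chart linearizations `A_g`, `A_h` of `VolumeChartFormula.lean` and
compare determinants of endomorphisms of `ℝ⁴` through the sibling lemmas `|det T| ≤ K⁴` if
`‖T v‖ ≤ K‖v‖`, `k⁴ ≤ |det T|` if `k‖v‖ ≤ ‖T v‖` of
`EntropyRungSubcylindricalRecognitionInjOnVolumeComparison.lean`). Also: the Riemannian measure
is finite on compact sets (`isFiniteMeasureOnCompacts_riemVolume`).

## References

* H. Federer, *Geometric Measure Theory*, Springer 1969, §3.2.3 (area formula), §3.2.46
  (Hausdorff measure of a Riemannian manifold). [Federer1969]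
* I. Chavel, *Riemannian Geometry: A Modern Introduction*, 2nd ed., CUP 2006, §III.3, (III.3.6)
  (integration in local coordinates). [Chavel2006]
-/

noncomputable section

-- the prescribed namespace `Summit.<Summit>.<Problem>.…` repeats `SmoothPoincare4` (summit = problem)
set_option linter.dupNamespace false

namespace Summit.SmoothPoincare4.SmoothPoincare4.Theorems.NoncompactShrinkerGapTransplantComparison

open scoped Manifold ContDiff ENNReal NNReal Topology Bundle
open MeasureTheory Set
open Literature.Geometry.Lorentzian Literature.Geometry.Riemannian
open Summit.SmoothPoincare4.SmoothPoincare4.Theorems.SubcylindricalRecognition.AncientSphereRigidity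
  (abs_det_le_pow_of_norm_le pow_le_abs_det_of_mul_norm_le)

/-! ### The identification `ℝ³ × ℝ ≅ ℝ⁴` -/

section Identification

/-- **`ℝ³ × ℝ ≅ ℝ⁴`, isometrically for `|u|² + s²` and measure preservingly**: there is a continuous
linear equivalence `L : ℝ³ × ℝ ≃ ℝ⁴` with `‖L (u, s)‖² = ‖u‖² + s²` pushing the product Lebesgue
measure to Lebesgue measure (compose `WithLp.toLp 2 : ℝ³ × ℝ → ℝ³ ×₂ ℝ`, which is measure
preserving, with a linear isometry of the `4`-dimensional inner product space `ℝ³ ×₂ ℝ` onto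
`ℝ⁴`). [folklore] -/
theorem exists_prodEquiv :
    ∃ L : (E3 × ℝ) ≃L[ℝ] E4, (∀ (u : E3) (s : ℝ), ‖L (u, s)‖ ^ 2 = ‖u‖ ^ 2 + s ^ 2) ∧
      MeasurePreserving L volume volume := by
  have hfin : Module.finrank ℝ (WithLp 2 (E3 × ℝ)) = Module.finrank ℝ E4 := by
    rw [(WithLp.linearEquiv 2 ℝ (E3 × ℝ)).finrank_eq, finrank_euclideanSpace_fin]
    simp
  let iso : WithLp 2 (E3 × ℝ) ≃ₗᵢ[ℝ] E4 :=
    (stdOrthonormalBasis ℝ (WithLp 2 (E3 × ℝ))).equiv (stdOrthonormalBasis ℝ E4) (finCongr hfin)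
  let L : (E3 × ℝ) ≃L[ℝ] E4 :=
    (WithLp.prodContinuousLinearEquiv 2 ℝ E3 ℝ).symm.trans iso.toContinuousLinearEquiv
  have hL : ∀ q : E3 × ℝ, L q = iso (WithLp.toLp 2 q) := fun q ↦ rfl
  refine ⟨L, fun u s ↦ ?_, ?_⟩
  · rw [hL, LinearIsometryEquiv.norm_map, WithLp.prod_norm_sq_eq_of_L2]
    simp
  · have h := (iso.measurePreserving).comp (WithLp.volume_preserving_toLp E3 ℝ)
    have hfun : (⇑L : E3 × ℝ → E4) = ⇑iso ∘ WithLp.toLp 2 := funext hL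
    rw [hfun]
    exact h
end Identification

/-! ### The Jacobian of a transplant read in charts, pointwise -/

section Pointwise

variable {M : Type*} [TopologicalSpace M] [ChartedSpace E4 M] [IsManifold (𝓡 4) ∞ M]
  {N : Type*} [TopologicalSpace N] [ChartedSpace E3 N] [IsManifold (𝓡 3) ∞ N]

omit [IsManifold (𝓡 3) ∞ N] in
/-- **The differential of `(z, t) ↦ (φ⁻¹ z, t)`** (`φ` the extended chart of `N` at `x`) at a point
over the chart target is `(a, b) ↦ (D(φ⁻¹)(z) a, b)`. [folklore] -/
theorem mfderiv_chartSymm_prod [IsManifold (𝓡 3) 1 N] (x : N) {q : E3 × ℝ}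
    (hq : q.1 ∈ (extChartAt (𝓡 3) x).target) :
    MDifferentiableAt 𝓘(ℝ, E3 × ℝ) ((𝓡 3).prod 𝓘(ℝ, ℝ))
      (fun q : E3 × ℝ ↦ ((extChartAt (𝓡 3) x).symm q.1, q.2)) q ∧
    ∀ v : E3 × ℝ, mfderiv 𝓘(ℝ, E3 × ℝ) ((𝓡 3).prod 𝓘(ℝ, ℝ))
        (fun q : E3 × ℝ ↦ ((extChartAt (𝓡 3) x).symm q.1, q.2)) q v =
      (mfderivWithin 𝓘(ℝ, E3) (𝓡 3) (extChartAt (𝓡 3) x).symm (range (𝓡 3)) q.1 v.1, v.2) := by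
  set φ := extChartAt (𝓡 3) x with hφ
  have h1 : MDifferentiableAt 𝓘(ℝ, E3) (𝓡 3) φ.symm q.1 := by
    have h := mdifferentiableWithinAt_extChartAt_symm (I := 𝓡 3) hq
    rwa [ModelWithCorners.Boundaryless.range_eq_univ, mdifferentiableWithinAt_univ] at h
  have hfst : MDifferentiableAt 𝓘(ℝ, E3 × ℝ) 𝓘(ℝ, E3) (Prod.fst : E3 × ℝ → E3) q :=
    mdifferentiableAt_iff_differentiableAt.2 differentiableAt_fst
  have hsnd : MDifferentiableAt 𝓘(ℝ, E3 × ℝ) 𝓘(ℝ, ℝ) (Prod.snd : E3 × ℝ → ℝ) q :=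
    mdifferentiableAt_iff_differentiableAt.2 differentiableAt_snd
  have hc : MDifferentiableAt 𝓘(ℝ, E3 × ℝ) (𝓡 3) (φ.symm ∘ Prod.fst : E3 × ℝ → N) q :=
    h1.comp q hfst
  refine ⟨hc.prodMk hsnd, fun v ↦ ?_⟩
  have e0 : mfderiv 𝓘(ℝ, E3 × ℝ) ((𝓡 3).prod 𝓘(ℝ, ℝ)) (fun q : E3 × ℝ ↦ (φ.symm q.1, q.2)) q =
      (mfderiv 𝓘(ℝ, E3 × ℝ) (𝓡 3) (φ.symm ∘ Prod.fst : E3 × ℝ → N) q).prod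
        (mfderiv 𝓘(ℝ, E3 × ℝ) 𝓘(ℝ, ℝ) (Prod.snd : E3 × ℝ → ℝ) q) :=
    hc.mfderiv_prod hsnd
  have e1 : mfderiv 𝓘(ℝ, E3 × ℝ) (𝓡 3) (φ.symm ∘ Prod.fst : E3 × ℝ → N) q =
      (mfderiv 𝓘(ℝ, E3) (𝓡 3) φ.symm q.1).comp
        (mfderiv 𝓘(ℝ, E3 × ℝ) 𝓘(ℝ, E3) (Prod.fst : E3 × ℝ → E3) q) :=
    mfderiv_comp q h1 hfst
  have e2 : mfderiv 𝓘(ℝ, E3 × ℝ) 𝓘(ℝ, E3) (Prod.fst : E3 × ℝ → E3) q =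
      ContinuousLinearMap.fst ℝ E3 ℝ := by
    rw [mfderiv_eq_fderiv, fderiv_fst]
  have e3 : mfderiv 𝓘(ℝ, E3 × ℝ) 𝓘(ℝ, ℝ) (Prod.snd : E3 × ℝ → ℝ) q =
      ContinuousLinearMap.snd ℝ E3 ℝ := by
    rw [mfderiv_eq_fderiv, fderiv_snd]
  have e4 : mfderiv 𝓘(ℝ, E3) (𝓡 3) φ.symm q.1 =
      mfderivWithin 𝓘(ℝ, E3) (𝓡 3) φ.symm (range (𝓡 3)) q.1 := by
    rw [ModelWithCorners.Boundaryless.range_eq_univ, mfderivWithin_univ]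
  have e5 : (mfderiv 𝓘(ℝ, E3 × ℝ) (𝓡 3) (φ.symm ∘ Prod.fst : E3 × ℝ → N) q) v =
      mfderivWithin 𝓘(ℝ, E3) (𝓡 3) φ.symm (range (𝓡 3)) q.1 v.1 := by
    rw [e1]
    change (mfderiv 𝓘(ℝ, E3) (𝓡 3) φ.symm q.1)
      ((mfderiv 𝓘(ℝ, E3 × ℝ) 𝓘(ℝ, E3) (Prod.fst : E3 × ℝ → E3) q) v) = _
    rw [e2, e4]
    rfl
  rw [e0]
  change ((mfderiv 𝓘(ℝ, E3 × ℝ) (𝓡 3) (φ.symm ∘ Prod.fst : E3 × ℝ → N) q) v,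
    (mfderiv 𝓘(ℝ, E3 × ℝ) 𝓘(ℝ, ℝ) (Prod.snd : E3 × ℝ → ℝ) q) v) = _
  rw [e5, e3]
  rfl

set_option maxHeartbeats 800000 in
/-- **Pointwise Jacobian bounds for a transplant.** Let `g` be Riemannian on `M⁴`, `h`
Riemannian on `N³`, `Φ : N × ℝ → M` smooth on the open `U` with
`(1-η)(h(v,v) + s²) ≤ g(dΦ(v,s), dΦ(v,s)) ≤ (1+η)(h(v,v) + s²)` on `U` (`0 ≤ η < 1`), `L` the
identification `ℝ³ × ℝ ≅ ℝ⁴` with `‖L(u,s)‖² = ‖u‖² + s²`, `φ_N`, `φ_M` the extended charts at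
`q₀`, `p₀`, and `f = φ_M ∘ Φ ∘ (φ_N⁻¹ × id)`. At a point `q = (z, t)` with `z ∈ φ_N.target`,
`(φ_N⁻¹ z, t) ∈ U` mapped by `Φ` into the domain of `φ_M`, the map `f` is differentiable and
`(1-η)² √det h_{ij}(z) ≤ |det (Df(q) ∘ L⁻¹)| · √det g_{ij}(f q) ≤ (1+η)² √det h_{ij}(z)`.
Proof: linearise, `√det g_{ij} = |det A_g|` with `‖A_g w‖ = |Dφ_M⁻¹ w|_g`, `√det h_{ij} = |det A_h|`
with `‖A_h a‖ = |Dφ_N⁻¹ a|_h`; the endomorphism `R = A_g ∘ Df(q) ∘ (A_h × id)⁻¹ ∘ L⁻¹` of `ℝ⁴`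
satisfies `(1-η)‖x‖² ≤ ‖R x‖² ≤ (1+η)‖x‖²`, whence `|det R| ∈ [(1-η)², (1+η)²]`, and
`|det (Df(q) ∘ L⁻¹)| · |det A_g| = |det R| · |det A_h|`. [folklore] -/
theorem jacobian_mul_density_bounds [T2Space M]
    (g : PseudoRiemannianMetric (𝓡 4) ∞ E4 (TangentSpace (𝓡 4) : M → Type _))
    (hg : g.IsRiemannian)
    (h : PseudoRiemannianMetric (𝓡 3) ∞ E3 (TangentSpace (𝓡 3) : N → Type _))
    (hh : h.IsRiemannian) {U : Set (N × ℝ)} {Φ : N × ℝ → M} {η : ℝ} (h0 : 0 ≤ η) (hη : η < 1)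
    (hU : IsOpen U) (hΦ : ContMDiffOn ((𝓡 3).prod 𝓘(ℝ, ℝ)) (𝓡 4) ∞ Φ U)
    (hD : ∀ p ∈ U, ∀ (v : E3) (s : ℝ), (1 - η) * (h.val p.1 v v + s ^ 2) ≤
        g.val (Φ p) (mfderiv ((𝓡 3).prod 𝓘(ℝ, ℝ)) (𝓡 4) Φ p (v, s))
          (mfderiv ((𝓡 3).prod 𝓘(ℝ, ℝ)) (𝓡 4) Φ p (v, s)) ∧
        g.val (Φ p) (mfderiv ((𝓡 3).prod 𝓘(ℝ, ℝ)) (𝓡 4) Φ p (v, s))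
          (mfderiv ((𝓡 3).prod 𝓘(ℝ, ℝ)) (𝓡 4) Φ p (v, s)) ≤ (1 + η) * (h.val p.1 v v + s ^ 2))
    (L : (E3 × ℝ) ≃L[ℝ] E4) (hL : ∀ (u : E3) (s : ℝ), ‖L (u, s)‖ ^ 2 = ‖u‖ ^ 2 + s ^ 2)
    (q₀ : N) (p₀ : M) {q : E3 × ℝ} (hq : q.1 ∈ (extChartAt (𝓡 3) q₀).target)
    (hqU : ((extChartAt (𝓡 3) q₀).symm q.1, q.2) ∈ U)
    (hsrc : Φ ((extChartAt (𝓡 3) q₀).symm q.1, q.2) ∈ (chartAt E4 p₀).source) :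
    DifferentiableAt ℝ
      (extChartAt (𝓡 4) p₀ ∘ Φ ∘ fun q : E3 × ℝ ↦ ((extChartAt (𝓡 3) q₀).symm q.1, q.2)) q ∧
    (1 - η) ^ 2 * Real.sqrt (chartGramMatrix (h.toContMDiffRiemannianMetric hh) q₀ q.1).det ≤
      |((fderiv ℝ (extChartAt (𝓡 4) p₀ ∘ Φ ∘
            fun q : E3 × ℝ ↦ ((extChartAt (𝓡 3) q₀).symm q.1, q.2)) q).comp
          (L.symm : E4 →L[ℝ] E3 × ℝ)).det| *
        Real.sqrt (chartGramMatrix (g.toContMDiffRiemannianMetric hg) p₀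
          ((extChartAt (𝓡 4) p₀ ∘ Φ ∘
            fun q : E3 × ℝ ↦ ((extChartAt (𝓡 3) q₀).symm q.1, q.2)) q)).det ∧
    |((fderiv ℝ (extChartAt (𝓡 4) p₀ ∘ Φ ∘
            fun q : E3 × ℝ ↦ ((extChartAt (𝓡 3) q₀).symm q.1, q.2)) q).comp
          (L.symm : E4 →L[ℝ] E3 × ℝ)).det| *
        Real.sqrt (chartGramMatrix (g.toContMDiffRiemannianMetric hg) p₀
          ((extChartAt (𝓡 4) p₀ ∘ Φ ∘
            fun q : E3 × ℝ ↦ ((extChartAt (𝓡 3) q₀).symm q.1, q.2)) q)).det ≤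
      (1 + η) ^ 2 * Real.sqrt (chartGramMatrix (h.toContMDiffRiemannianMetric hh) q₀ q.1).det := by
  set φN := extChartAt (𝓡 3) q₀ with hφN
  set φM := extChartAt (𝓡 4) p₀ with hφM
  set eN : E3 × ℝ → N × ℝ := fun q ↦ (φN.symm q.1, q.2) with heN
  set p : N × ℝ := eN q with hp_def
  set y : N := φN.symm q.1 with hy_def
  letI iM : Bundle.RiemannianBundle (fun x : M ↦ TangentSpace (𝓡 4) x) :=
    ⟨(g.toContMDiffRiemannianMetric hg).toContinuousRiemannianMetric.toRiemannianMetric⟩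
  letI iN : Bundle.RiemannianBundle (fun x : N ↦ TangentSpace (𝓡 3) x) :=
    ⟨(h.toContMDiffRiemannianMetric hh).toContinuousRiemannianMetric.toRiemannianMetric⟩
  have hy_src : y ∈ (chartAt E3 q₀).source := by
    rw [← extChartAt_source (𝓡 3)]; exact φN.map_target hq
  have hφNy : φN y = q.1 := φN.right_inv hq
  have hsrc' : Φ p ∈ φM.source := by rw [hφM, extChartAt_source]; exact hsrc
  have hz : φM (Φ p) ∈ φM.target := φM.map_source hsrc'
  have h1η : 0 < 1 - η := by linarith
  -- chart linearizations and the densities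
  obtain ⟨Ag, hAg⟩ := exists_norm_eq_norm_symmL (I := 𝓡 4) p₀ (Φ p)
  have hG : Real.sqrt (chartGramMatrix (g.toContMDiffRiemannianMetric hg) p₀ (φM (Φ p))).det =
      |LinearMap.det (Ag : E4 →ₗ[ℝ] E4)| := by
    rw [← sqrt_det_gram_symmL_eq_abs_det (EuclideanSpace.basisFun (Fin 4) ℝ) p₀ (Φ p) hAg]
    congr 3
    ext i j
    rw [Matrix.of_apply, chartGramMatrix_eq_inner_symmL _ p₀ hz, EuclideanSpace.basisFun_apply,
      EuclideanSpace.basisFun_apply, φM.left_inv hsrc']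
  obtain ⟨Ah, hAh⟩ := exists_norm_eq_norm_symmL (I := 𝓡 3) q₀ y
  have hH : Real.sqrt (chartGramMatrix (h.toContMDiffRiemannianMetric hh) q₀ q.1).det =
      |LinearMap.det (Ah : E3 →ₗ[ℝ] E3)| := by
    rw [← sqrt_det_gram_symmL_eq_abs_det (EuclideanSpace.basisFun (Fin 3) ℝ) q₀ y hAh]
    congr 3
    ext i j
    rw [Matrix.of_apply, chartGramMatrix_eq_inner_symmL _ q₀ hq, EuclideanSpace.basisFun_apply,
      EuclideanSpace.basisFun_apply]
  obtain ⟨Ae, hAe⟩ := exists_continuousLinearEquiv_of_norm_eq_norm_symmL q₀ y hy_src hAh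
  -- differentiability of `Φ`, of the charts and of `eN`
  have hΦp : MDifferentiableAt ((𝓡 3).prod 𝓘(ℝ, ℝ)) (𝓡 4) Φ p :=
    (hΦ.contMDiffAt (hU.mem_nhds hqU)).mdifferentiableAt (by simp)
  have hφMd : MDifferentiableAt (𝓡 4) 𝓘(ℝ, E4) φM (Φ p) := mdifferentiableAt_extChartAt hsrc
  obtain ⟨heNd, heND⟩ := mfderiv_chartSymm_prod q₀ hq
  have hΦe : MDifferentiableAt 𝓘(ℝ, E3 × ℝ) (𝓡 4) (Φ ∘ eN) q := hΦp.comp q heNd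
  have hFd : MDifferentiableAt 𝓘(ℝ, E3 × ℝ) 𝓘(ℝ, E4) (φM ∘ Φ ∘ eN) q := hφMd.comp q hΦe
  have hfd : DifferentiableAt ℝ (φM ∘ Φ ∘ eN) q := mdifferentiableAt_iff_differentiableAt.1 hFd
  set D : E3 × ℝ →L[ℝ] E4 := fderiv ℝ (φM ∘ Φ ∘ eN) q with hD_def
  have hDf : D = (mfderiv (𝓡 4) 𝓘(ℝ, E4) φM (Φ p)).comp
      ((mfderiv ((𝓡 3).prod 𝓘(ℝ, ℝ)) (𝓡 4) Φ p).comp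
        (mfderiv 𝓘(ℝ, E3 × ℝ) ((𝓡 3).prod 𝓘(ℝ, ℝ)) eN q)) := by
    rw [hD_def, ← mfderiv_eq_fderiv, mfderiv_comp q hφMd hΦe, mfderiv_comp q hΦp heNd]
    rfl
  -- `D(φ_M⁻¹)(D v) = dΦ (DeN v)`
  have hkey : ∀ v : E3 × ℝ,
      (trivializationAt E4 (TangentSpace (𝓡 4)) p₀).symmL ℝ (Φ p) (D v) =
        mfderiv ((𝓡 3).prod 𝓘(ℝ, ℝ)) (𝓡 4) Φ p
          (mfderiv 𝓘(ℝ, E3 × ℝ) ((𝓡 3).prod 𝓘(ℝ, ℝ)) eN q v) := by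
    intro v
    rw [TangentBundle.symmL_trivializationAt hsrc, hDf]
    have hc := mfderivWithin_extChartAt_symm_comp_mfderiv_extChartAt' (I := 𝓡 4) hsrc'
    exact congr($hc (mfderiv ((𝓡 3).prod 𝓘(ℝ, ℝ)) (𝓡 4) Φ p
      (mfderiv 𝓘(ℝ, E3 × ℝ) ((𝓡 3).prod 𝓘(ℝ, ℝ)) eN q v)))
  have hnormM : ∀ w : TangentSpace (𝓡 4) (Φ p), ‖w‖ ^ 2 = g.val (Φ p) w w := fun w ↦ by
    rw [← real_inner_self_eq_norm_sq w]; rfl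
  have hnormN : ∀ u : TangentSpace (𝓡 3) y, ‖u‖ ^ 2 = h.val y u u := fun u ↦ by
    rw [← real_inner_self_eq_norm_sq u]; rfl
  have hT : ∀ v : E3 × ℝ, ‖Ag (D v)‖ ^ 2 =
      g.val (Φ p) (mfderiv ((𝓡 3).prod 𝓘(ℝ, ℝ)) (𝓡 4) Φ p
          (mfderiv 𝓘(ℝ, E3 × ℝ) ((𝓡 3).prod 𝓘(ℝ, ℝ)) eN q v))
        (mfderiv ((𝓡 3).prod 𝓘(ℝ, ℝ)) (𝓡 4) Φ p
          (mfderiv 𝓘(ℝ, E3 × ℝ) ((𝓡 3).prod 𝓘(ℝ, ℝ)) eN q v)) := by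
    intro v
    rw [hAg, hnormM, hkey v]
  -- the source quadratic form `h ⊕ dt²` of `DeN v` is `‖L (Ae v.1, v.2)‖²`
  have hQ : ∀ v : E3 × ℝ,
      h.val p.1 (mfderiv 𝓘(ℝ, E3 × ℝ) ((𝓡 3).prod 𝓘(ℝ, ℝ)) eN q v).1
          (mfderiv 𝓘(ℝ, E3 × ℝ) ((𝓡 3).prod 𝓘(ℝ, ℝ)) eN q v).1 +
        (mfderiv 𝓘(ℝ, E3 × ℝ) ((𝓡 3).prod 𝓘(ℝ, ℝ)) eN q v).2 ^ 2 = ‖L (Ae v.1, v.2)‖ ^ 2 := by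
    intro v
    rw [hL, hAe, heND v, hAh, hnormN, TangentBundle.symmL_trivializationAt hy_src, hφNy]
    rfl
  -- the endomorphism `R` of `ℝ⁴`
  set P : (E3 × ℝ) ≃L[ℝ] (E3 × ℝ) := Ae.prodCongr (ContinuousLinearEquiv.refl ℝ ℝ) with hP_def
  have hPv : ∀ v : E3 × ℝ, P v = (Ae v.1, v.2) := fun v ↦ rfl
  set R : E4 →L[ℝ] E4 :=
    (Ag ∘L D) ∘L ((P.symm : (E3 × ℝ) →L[ℝ] (E3 × ℝ)) ∘L (L.symm : E4 →L[ℝ] (E3 × ℝ))) with hR_def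
  have hRv : ∀ x : E4, R x = Ag (D (P.symm (L.symm x))) := fun x ↦ rfl
  have hPL : ∀ x : E4, L (Ae (P.symm (L.symm x)).1, (P.symm (L.symm x)).2) = x := by
    intro x
    rw [← hPv, ContinuousLinearEquiv.apply_symm_apply, ContinuousLinearEquiv.apply_symm_apply]
  have hRsq : ∀ x : E4, (1 - η) * ‖x‖ ^ 2 ≤ ‖R x‖ ^ 2 ∧ ‖R x‖ ^ 2 ≤ (1 + η) * ‖x‖ ^ 2 := by
    intro x
    have hb := hD p hqU (mfderiv 𝓘(ℝ, E3 × ℝ) ((𝓡 3).prod 𝓘(ℝ, ℝ)) eN q (P.symm (L.symm x))).1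
      (mfderiv 𝓘(ℝ, E3 × ℝ) ((𝓡 3).prod 𝓘(ℝ, ℝ)) eN q (P.symm (L.symm x))).2
    rw [hQ, hPL x] at hb
    rw [hRv, hT]
    exact hb
  have hup : ∀ x : E4, ‖R x‖ ≤ Real.sqrt (1 + η) * ‖x‖ := by
    intro x
    rw [← Real.sqrt_sq (norm_nonneg (R x)), ← Real.sqrt_sq (norm_nonneg x),
      ← Real.sqrt_mul (by linarith)]
    exact Real.sqrt_le_sqrt (hRsq x).2
  have hlow : ∀ x : E4, Real.sqrt (1 - η) * ‖x‖ ≤ ‖R x‖ := by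
    intro x
    rw [← Real.sqrt_sq (norm_nonneg (R x)), ← Real.sqrt_sq (norm_nonneg x),
      ← Real.sqrt_mul h1η.le]
    exact Real.sqrt_le_sqrt (hRsq x).1
  have hn : Module.finrank ℝ E4 = 4 := finrank_euclideanSpace_fin
  have hdet_le : |LinearMap.det (R : E4 →ₗ[ℝ] E4)| ≤ (1 + η) ^ 2 := by
    have h := abs_det_le_pow_of_norm_le (R : E4 →ₗ[ℝ] E4) (Real.sqrt_nonneg _) hup
    rw [hn] at h
    calc _ ≤ Real.sqrt (1 + η) ^ 4 := h
      _ = (Real.sqrt (1 + η) ^ 2) ^ 2 := by ring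
      _ = (1 + η) ^ 2 := by rw [Real.sq_sqrt (by linarith)]
  have hdet_ge : (1 - η) ^ 2 ≤ |LinearMap.det (R : E4 →ₗ[ℝ] E4)| := by
    have h := pow_le_abs_det_of_mul_norm_le (R : E4 →ₗ[ℝ] E4) (Real.sqrt_pos.2 h1η) hlow
    rw [hn] at h
    calc (1 - η) ^ 2 = (Real.sqrt (1 - η) ^ 2) ^ 2 := by rw [Real.sq_sqrt h1η.le]
      _ = Real.sqrt (1 - η) ^ 4 := by ring
      _ ≤ _ := h
  -- determinant bookkeeping: `A_g ∘ (D ∘ L⁻¹) = R ∘ (L ∘ P ∘ L⁻¹)`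
  have hfac : ((Ag ∘L (D ∘L (L.symm : E4 →L[ℝ] (E3 × ℝ)))) : E4 →ₗ[ℝ] E4) =
      (R : E4 →ₗ[ℝ] E4) ∘ₗ ((L.toLinearEquiv : (E3 × ℝ) →ₗ[ℝ] E4) ∘ₗ
        (P : (E3 × ℝ) →ₗ[ℝ] (E3 × ℝ)) ∘ₗ (L.toLinearEquiv.symm : E4 →ₗ[ℝ] (E3 × ℝ))) := by
    apply LinearMap.ext
    intro x
    change Ag (D (L.symm x)) = R (L (P (L.symm x)))
    rw [hRv, ContinuousLinearEquiv.symm_apply_apply, ContinuousLinearEquiv.symm_apply_apply]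
  have hdetP : LinearMap.det (P : (E3 × ℝ) →ₗ[ℝ] (E3 × ℝ)) = LinearMap.det (Ah : E3 →ₗ[ℝ] E3) := by
    have hPm : (P : (E3 × ℝ) →ₗ[ℝ] (E3 × ℝ)) = LinearMap.prodMap (Ah : E3 →ₗ[ℝ] E3) LinearMap.id := by
      apply LinearMap.ext
      intro v
      change P v = (Ah v.1, v.2)
      rw [hPv, hAe]
    rw [hPm, LinearMap.det_prodMap, LinearMap.det_id, mul_one]
  have hdet1 : LinearMap.det ((Ag ∘L (D ∘L (L.symm : E4 →L[ℝ] (E3 × ℝ)))) : E4 →ₗ[ℝ] E4) =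
      LinearMap.det (Ag : E4 →ₗ[ℝ] E4) *
        LinearMap.det ((D ∘L (L.symm : E4 →L[ℝ] (E3 × ℝ)) : E4 →L[ℝ] E4) : E4 →ₗ[ℝ] E4) := by
    rw [ContinuousLinearMap.toLinearMap_comp, LinearMap.det_comp]
  have hdet2 : LinearMap.det ((Ag ∘L (D ∘L (L.symm : E4 →L[ℝ] (E3 × ℝ)))) : E4 →ₗ[ℝ] E4) =
      LinearMap.det (R : E4 →ₗ[ℝ] E4) * LinearMap.det (Ah : E3 →ₗ[ℝ] E3) := by
    rw [hfac, LinearMap.det_comp, LinearMap.det_conj _ L.toLinearEquiv, hdetP]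
  have hprod : |((fderiv ℝ (φM ∘ Φ ∘ eN) q).comp (L.symm : E4 →L[ℝ] E3 × ℝ)).det| *
      Real.sqrt (chartGramMatrix (g.toContMDiffRiemannianMetric hg) p₀ (φM (Φ p))).det =
      |LinearMap.det (R : E4 →ₗ[ℝ] E4)| *
        Real.sqrt (chartGramMatrix (h.toContMDiffRiemannianMetric hh) q₀ q.1).det := by
    rw [hG, hH, ← abs_mul, ← abs_mul, ← hdet2, hdet1, mul_comm]
  have hρ0 : 0 ≤ Real.sqrt (chartGramMatrix (h.toContMDiffRiemannianMetric hh) q₀ q.1).det :=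
    Real.sqrt_nonneg _
  refine ⟨hfd, ?_, ?_⟩
  · calc (1 - η) ^ 2 * Real.sqrt (chartGramMatrix (h.toContMDiffRiemannianMetric hh) q₀ q.1).det
        ≤ |LinearMap.det (R : E4 →ₗ[ℝ] E4)| *
          Real.sqrt (chartGramMatrix (h.toContMDiffRiemannianMetric hh) q₀ q.1).det := by gcongr
      _ = _ := hprod.symm
  · calc _ = |LinearMap.det (R : E4 →ₗ[ℝ] E4)| *
          Real.sqrt (chartGramMatrix (h.toContMDiffRiemannianMetric hh) q₀ q.1).det := hprod
      _ ≤ _ := by gcongr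

end Pointwise

/-! ### Two-sided comparison of `Vol_g ∘ Φ` with `dV_h ⊗ dt` -/

section Finite

variable {E : Type*} [NormedAddCommGroup E] [NormedSpace ℝ E] [FiniteDimensional ℝ E]
  {H : Type*} [TopologicalSpace H] {I : ModelWithCorners ℝ E H}
  {M : Type*} [TopologicalSpace M] [ChartedSpace H M] [IsManifold I ∞ M]
  [T3Space M] [MeasurableSpace M] [BorelSpace M] {n : ℕ∞ω}

/-- On a Riemannian manifold the Riemannian measure is finite on compact sets
(`riemannianVolume_lt_top_of_isCompact_holds`). [folklore] -/
theorem isFiniteMeasureOnCompacts_riemVolume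
    (g : PseudoRiemannianMetric I n E (TangentSpace I : M → Type _)) (hg : g.IsRiemannian) :
    IsFiniteMeasureOnCompacts g.riemVolume := by
  rw [PseudoRiemannianMetric.riemVolume_eq hg]
  exact ⟨fun K hK ↦ riemannianVolume_lt_top_of_isCompact_holds _ le_rfl hK⟩

end Finite

/-! ### The registered sub-goal of this file -/

/-- **Registered sub-goal `stub_transplantJacobian`** (pointwise Jacobian bounds for a transplant,
the statement of `jacobian_mul_density_bounds` with all binders explicit):
`(1-η)² √det h_{ij} ≤ |det (D(φ_M ∘ Φ ∘ (φ_N⁻¹ × id)) ∘ L⁻¹)| · √det g_{ij} ≤ (1+η)² √det h_{ij}`.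
[folklore] -/
theorem stub_transplantJacobian : ∀ (M : Type) [TopologicalSpace M] [T2Space M] [ChartedSpace E4 M] [IsManifold (𝓡 4) ∞ M] (N : Type) [TopologicalSpace N] [ChartedSpace E3 N] [IsManifold (𝓡 3) ∞ N] (g : PseudoRiemannianMetric (𝓡 4) ∞ E4 (TangentSpace (𝓡 4) : M → Type _)) (hg : g.IsRiemannian) (h : PseudoRiemannianMetric (𝓡 3) ∞ E3 (TangentSpace (𝓡 3) : N → Type _)) (hh : h.IsRiemannian) (U : Set (N × ℝ)) (Φ : N × ℝ → M) (η : ℝ), 0 ≤ η → η < 1 → IsOpen U → ContMDiffOn ((𝓡 3).prod 𝓘(ℝ, ℝ)) (𝓡 4) ∞ Φ U → (∀ p ∈ U, ∀ (v : E3) (s : ℝ), (1 - η) * (h.val p.1 v v + s ^ 2) ≤ g.val (Φ p) (mfderiv ((𝓡 3).prod 𝓘(ℝ, ℝ)) (𝓡 4) Φ p (v, s)) (mfderiv ((𝓡 3).prod 𝓘(ℝ, ℝ)) (𝓡 4) Φ p (v, s)) ∧ g.val (Φ p) (mfderiv ((𝓡 3).prod 𝓘(ℝ, ℝ)) (𝓡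 4) Φ p (v, s)) (mfderiv ((𝓡 3).prod 𝓘(ℝ, ℝ)) (𝓡 4) Φ p (v, s)) ≤ (1 + η) * (h.val p.1 v v + s ^ 2)) → ∀ (L : (E3 × ℝ) ≃L[ℝ] E4), (∀ (u : E3) (s : ℝ), ‖L (u, s)‖ ^ 2 = ‖u‖ ^ 2 + s ^ 2) → ∀ (q₀ : N) (p₀ : M) (q : E3 × ℝ), q.1 ∈ (extChartAt (𝓡 3) q₀).target → ((extChartAt (𝓡 3) q₀).symm q.1, q.2) ∈ U → Φ ((extChartAt (𝓡 3) q₀).symm q.1, q.2) ∈ (chartAt E4 p₀).source → DifferentiableAt ℝ (extChartAt (𝓡 4) p₀ ∘ Φ ∘ fun q : E3 × ℝ ↦ ((extChartAt (𝓡 3) q₀).symm q.1, q.2)) q ∧ (1 - η) ^ 2 * Real.sqrt (chartGramMatrix (h.toContMDiffRiemannianMetric hh) q₀ q.1).det ≤ |((fderiv ℝ (extChartAt (𝓡 4) p₀ ∘ Φ ∘ fun q : E3 × ℝ ↦ ((extChartAt (𝓡 3) q₀).symm q.1, q.2)) q).comp (L.symm : E4 →L[ℝ] E3 × ℝ)).det|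 * Real.sqrt (chartGramMatrix (g.toContMDiffRiemannianMetric hg) p₀ ((extChartAt (𝓡 4) p₀ ∘ Φ ∘ fun q : E3 × ℝ ↦ ((extChartAt (𝓡 3) q₀).symm q.1, q.2)) q)).det ∧ |((fderiv ℝ (extChartAt (𝓡 4) p₀ ∘ Φ ∘ fun q : E3 × ℝ ↦ ((extChartAt (𝓡 3) q₀).symm q.1, q.2)) q).comp (L.symm : E4 →L[ℝ] E3 × ℝ)).det| * Real.sqrt (chartGramMatrix (g.toContMDiffRiemannianMetric hg) p₀ ((extChartAt (𝓡 4) p₀ ∘ Φ ∘ fun q : E3 × ℝ ↦ ((extChartAt (𝓡 3) q₀).symm q.1, q.2)) q)).det ≤ (1 + η) ^ 2 * Real.sqrt (chartGramMatrix (h.toContMDiffRiemannianMetric hh) q₀ q.1).det := by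
  intro M _ _ _ _ N _ _ _ g hg h hh U Φ η h0 hη hU hΦ hD L hL q₀ p₀ q hq hqU hsrc
  exact jacobian_mul_density_bounds g hg h hh h0 hη hU hΦ hD L hL q₀ p₀ hq hqU hsrc

end Summit.SmoothPoincare4.SmoothPoincare4.Theorems.NoncompactShrinkerGapTransplantComparison
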